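import Mathlib.Algebra.BigOperators.Group.Finset.Basic
import Mathlib.Algebra.GroupWithZero.Basic
import Mathlib.Data.Fintype.BigOperators
import Mathlib.Logic.Equiv.Defs
import HarnessLib

/-!
# Level calculus for adapted charts, II-0: re-indexing exponent vectors along the lower parameters

Crux `Valuative.LuAlphaPTorsor` (stmt-ResolutionOfSingularities-0641), line `pfaff-line-log-final-forms`,
lead seat c4 — bookkeeping for the level induction (S3*) of the rank `≥ 2` Abhyankar core: for an
enumeration `e : Fin nS ≃ {i // lv i < top}` of the lower indices, extension by zero of an
exponent vector `Fin nS → ℤ` to `Fin n → ℤ` (`Function.extend`) and the corresponding product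
identity `ap_prod_ext` (registered anchor, closed form). [folklore]
-/

set_option linter.dupNamespace false

namespace Summit.ResolutionOfSingularities.ResolutionOfSingularities.Theorems.PfaffLine

/-! ### Re-indexing Laurent exponents along the lower parameters -/

section Ext

variable {n nS : ℕ} (lv : Fin n → ℕ) (top : ℕ) (e : Fin nS ≃ {i : Fin n // lv i < top})

/-- Injectivity of the enumeration of the lower indices. [folklore] -/
theorem ap_val_comp_injective : Function.Injective (fun j => ((e j : {i : Fin n // lv i < top}) : Fin n)) :=
  fun _ _ h => e.injective (Subtype.ext h)

/-- Extension by zero of a lower exponent vector vanishes on the top indices. [folklore] -/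
theorem ap_ext_apply_top (m : Fin nS → ℤ) (i : Fin n) (hi : ¬ lv i < top) :
    Function.extend (fun j => ((e j : {i : Fin n // lv i < top}) : Fin n)) m 0 i = 0 := by
  rw [Function.extend_apply']
  · rfl
  · rintro ⟨j, rfl⟩; exact hi (e j).2

/-- Extension by zero of a lower exponent vector on a lower index. [folklore] -/
theorem ap_ext_apply_low (m : Fin nS → ℤ) (j : Fin nS) :
    Function.extend (fun j => ((e j : {i : Fin n // lv i < top}) : Fin n)) m 0 (e j) = m j :=
  (ap_val_comp_injective lv top e).extend_apply _ _ _

/-- A vector supported on the lower indices is the extension of its restriction. [folklore] -/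
theorem ap_ext_restrict (m : Fin n → ℤ) (hm : ∀ i, ¬ lv i < top → m i = 0) :
    Function.extend (fun j => ((e j : {i : Fin n // lv i < top}) : Fin n)) (fun j => m (e j)) 0 = m := by
  funext i
  by_cases hi : lv i < top
  · have : i = ((e (e.symm ⟨i, hi⟩) : {i : Fin n // lv i < top}) : Fin n) := by simp
    have h := ap_ext_apply_low lv top e (fun j => m (e j)) (e.symm ⟨i, hi⟩)
    simp only [Equiv.apply_symm_apply] at h
    exact h
  · rw [ap_ext_apply_top lv top e _ i hi, hm i hi]

end Ext

/-- Re-indexing a Laurent monomial along the extension by zero (registered anchor). [folklore] -/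
theorem ap_prod_ext : ∀ {n nS : ℕ} (lv : Fin n → ℕ) (top : ℕ) (e : Fin nS ≃ {i : Fin n // lv i < top}) {M : Type} [CommGroupWithZero M] (f : Fin n → M) (m : Fin nS → ℤ), (∏ i, f i ^ (Function.extend (fun j => ((e j : {i : Fin n // lv i < top}) : Fin n)) m 0 i)) = ∏ j, f (e j) ^ (m j) := by
  intro n nS lv top e M _ f m
  classical
  rw [← Fintype.prod_subtype_mul_prod_subtype (fun i => lv i < top)]
  have h2 : (∏ i : {i : Fin n // ¬ lv i < top},
      f i ^ (Function.extend (fun j => ((e j : {i : Fin n // lv i < top}) : Fin n)) m 0 i)) = 1 :=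
    Finset.prod_eq_one fun i _ => by rw [ap_ext_apply_top lv top e m i.1 i.2, zpow_zero]
  rw [h2, mul_one]
  exact Fintype.prod_equiv e.symm _ _ fun i => by
    have h := ap_ext_apply_low lv top e m (e.symm i)
    simp only [Equiv.apply_symm_apply] at h
    rw [h, Equiv.apply_symm_apply]

/-- Extension by zero of a vector supported on the residual levels `≥ ℓ`… precisely: if `m`
vanishes on the lower indices of level `≥ ℓ` (`ℓ ≤ top`), its extension vanishes on all indices
of level `≥ ℓ`. [folklore] -/
theorem ap_ext_vanish {n nS : ℕ} (lv : Fin n → ℕ) (top : ℕ) (e : Fin nS ≃ {i : Fin n // lv i < top})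
    (m : Fin nS → ℤ) (ℓ : ℕ) (hm : ∀ j, ℓ ≤ lv (e j) → m j = 0) :
    ∀ i, ℓ ≤ lv i → Function.extend (fun j => ((e j : {i : Fin n // lv i < top}) : Fin n)) m 0 i = 0 := by
  intro i hi
  by_cases hlt : lv i < top
  · have h := ap_ext_apply_low lv top e m (e.symm ⟨i, hlt⟩)
    simp only [Equiv.apply_symm_apply] at h
    rw [h]; exact hm _ (by simpa using hi)
  · exact ap_ext_apply_top lv top e m i hlt

/-- Restriction to the lower indices of a vector vanishing at the levels `≥ ℓ` (`ℓ ≤ top`) extends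
back to the vector. [folklore] -/
theorem ap_ext_restrict_of_le {n nS : ℕ} (lv : Fin n → ℕ) (top : ℕ) (e : Fin nS ≃ {i : Fin n // lv i < top})
    (m : Fin n → ℤ) (ℓ : ℕ) (hℓ : ℓ ≤ top) (hm : ∀ j, ℓ ≤ lv j → m j = 0) :
    Function.extend (fun j => ((e j : {i : Fin n // lv i < top}) : Fin n)) (fun j => m (e j)) 0 = m :=
  ap_ext_restrict lv top e m fun i hi => hm i (hℓ.trans (not_lt.mp hi))

/-- Product re-indexing for a vector vanishing at the levels `≥ ℓ` (`ℓ ≤ top`). [folklore] -/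
theorem ap_prod_restrict {n nS : ℕ} (lv : Fin n → ℕ) (top : ℕ) (e : Fin nS ≃ {i : Fin n // lv i < top})
    {M : Type} [CommGroupWithZero M] (f : Fin n → M) (m : Fin n → ℤ) (ℓ : ℕ)
    (hℓ : ℓ ≤ top) (hm : ∀ j, ℓ ≤ lv j → m j = 0) :
    (∏ i, f i ^ (m i)) = ∏ j, f (e j) ^ (m (e j)) := by
  conv_lhs => rw [← ap_ext_restrict_of_le lv top e m ℓ hℓ hm]
  exact ap_prod_ext lv top e f _

end Summit.ResolutionOfSingularities.ResolutionOfSingularities.Theorems.PfaffLine
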